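import Mathlib
import Summits.Ventures.FusionMHD.Models.CerfonFreidbergNstxLikeQHalfDefs
import HarnessLib

/-!
# Ventures/FusionMHD — Models/CerfonFreidbergNstxLikeQHalfPanels9.lean: KERNEL CHECK of panels 30, 31 (of 32) of the
# certified interior safety factor `q(ψ_N = 1/2)/F` of THE Cerfon–Freidberg NSTX-like instance (twin of `…IterLikeQHalfPanels*.lean`)

HONEST FRAMING (LADDER-GRIDFUSION three columns; CF rung, F2 item R2, NSTX-like twin).  One `decide +kernel` (≈ 103 s on the farm): for
each panel `j` listed, the per-panel obligation `CFNstxLike.QHalf.PanelCert.ok` (`Models/CerfonFreidbergNstxLikeQHalfDefs.lean`) — the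
Taylor-model run of `CFNstxLike.QHalf.progG` over the NSTX-like parameter box is ACCEPTED (every `log`/`sin`/`cos` composition and the `inv`
certificate), and the kernel's panel-integral enclosure of the polar `(6.35)` integrand along the approximant, the range of the flux residual
`U(ray m) − U_a/2`, the range of the approximant `m` and the range of the radial derivative `D_r(θ, m)` lie inside the integers claimed in
`panelCert9` (values read off a compiled `#eval` of the same functions, slack one unit of `2⁻⁶⁰`; probe `QProbeNF*.lean`, generator
`pub/gridfusion/models/gen-model-5/g8/mkdefsN.py`).  What these Booleans MEAN (real-number statements, uniformly over the parameter box ∋ THE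
NSTX-like instance) is proved once in `Models/CerfonFreidbergNstxLikeQHalfSound.lean`.  MODELLED: analytic Cerfon–Freidberg family; `q` of a
MODEL surface — nothing about a device or stability.  No `native_decide`.  Typer/prover: gridfusion-model-5 (g8), 2026-08-27.
Citations: Freidberg 2014 §6.3.5 (6.35) [Freidberg2014]; Mahboubi–Melquiond–Sibut-Pinote 2016 §3.2 Lemma 3 [MahboubiMelquiondSibutpinote2016].
-/

namespace Summit.Ventures.FusionMHD.Models.CFNstxLike.QHalf

/-- The certificate data of panels 30, 31 (NSTX-like): `inv` candidate (degree-12 fit of `(X·D_r)⁻¹` in the panel variable, scaled by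
`2⁶⁰`), Taylor degree, `inv` widening `2^elog2`, and the claimed integral / residual / `m`-range / `D_r`-range integers (× `2⁶⁰`). [instance data] -/
def panelCert9 : List PanelCert := [
  { j := 30, cand := [5206346257374622720, -1779323361283906048, 19235804612079349760, -5349496661761546240, 25216139316863811584, 46382591188767956992, -237649300925521231872, 702893341312047120384, -2175402951044936761344, 53048675787948261638144, -1235817490785135725903872, -66244847158407299384475648, 1284168805455359841633566720],
    deg := 12, elog2 := 33, plo := 287132630233668324, phi := 287132631287004447, eta := 52485681, mlo := 642765649891109695, mhi := 651723569475649228,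
    dlo := 355459418653656625, dhi := 360811022815635748 },
  { j := 31, cand := [5169389341666238464, -589497008663504128, 18893180616004177920, -1869652512159914752, 29590276659533180928, 12583502472220549120, -141530267463717339136, 205298142932794834944, -1523439441216381124608, -14141332851934881644544, -609705896056763432566784, 21875392273498885505155072, 903892193691905385234956288],
    deg := 14, elog2 := 37, plo := 282855099381374605, phi := 282855116334034730, eta := 991530347, mlo := 640277674279011739, mhi := 644069186008761673,
    dlo := 360050842871335647, dhi := 362360583290539929 }]

/-- **KERNEL CHECK** of panels 30, 31 of the NSTX-like surface `ψ_N = 1/2`. -/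
theorem panelCert9_ok : CFNstxLike.QHalf.panelCert9.all PanelCert.ok = true := by
  decide +kernel

end Summit.Ventures.FusionMHD.Models.CFNstxLike.QHalf
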